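import Summits.CriticalPhenomena.PercolationContinuityZ3.Theorems.PercNearOneGluingNoHeavyQuantGatedSliceMixLawWSide
import HarnessLib

/-!
# QUANT lane R8, T-DEC, leg (III), blob case — `LawDec.GatedSliceMixLaw'`, REGIME C3 PROVED (and the common zero inequality of C1–C4):
# the shifted atom `k₁ + a` of the moved law is NOT a `t`-low but a mid at most the target, `k₂` a giant, both atoms of the weak-mid law
# at most `j` — the exchange certificate with the single donor `k₁`, the twin idle; regime C4 (twin above the target) is the next file

builds on p205010 (kernel theorem, internal audit signed; external expert review pending)

Support file (`--supports stmt-CriticalPhenomena-4575`), QUANT lane typer seat prim-quant-stmt (gen 30), rung R8 of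
`run/shared/lean/prim/quant/LADDER.md`.  Memo `run/shared/lean/prim/quant/prim-quant-stmt-g30/MIXLAW-MIXTURES-G30.md` §6 (L).  Theorems only,
standard axioms, no sorries.  Tools: `…QuantGatedSliceMixLawExchange`, `…QuantGatedSliceMixLawWSide`.

THE REGIMES (the V318 family of lead g30: `μ₂ = {1, 20}`, `a = 2`, the twin `3` a useless mid; classes LmGGMM / LmGGmM / LMGGMM of the seat's
census, ≈ 3 % of the genuine instances).  Frame of `GatedSliceMixLaw'`; `2k₁ < t`, `k₁ ≤ j` (the low `k₁`; `k₁ = 0` allowed); `k₂ ≥ j+1`;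
`h + a ≤ j`, `2h ≥ t`; and the twin `ℓ = k₁ + a ≤ j` is NOT a `t`-low (`2ℓ ≥ t`).  C3: `ℓ ≤ t` — the twin is ignored (an idle absorber).
C4: `ℓ > t` and the twin is SATURATED by `k₁`: `m₁' ≤ m₁·usage(k₁, ℓ)` — `k₁` fills its twin first (`β = m₁'/usage(k₁,ℓ)`), the rest rides
`W`'s mids.  (When the twin can absorb all of `k₁` the moved law has no nonzero low left over; a `θ = 0` cell of the Q-alone side.)  In both
regimes every zero rides the giants `k₂`, `k₂ + a`, the mixing ratio is the balance point `ρ = k₁'/K_{k₁}` (`k₁'` the donated mass), and with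
`usage(k₁,ℓ)(ℓ − t) ≤ t − k₁` (C4) the zero inequality `y(z + ρw₀) ≤ (1−y)(1−z)λ` reduces to regime C1's: `y(zS + (1−z)(1−λ)(S − k₁ − agz)) ≤
(1−y)(1−z)λS ⟸ y·k₂ ≤ S` (`zero_ineq_of_TA`).  Exact census of the seat: 0 failures (certL*.py); `W_h ∉ D` not needed.

* `LawDec.zero_ineq_of_TA` — the common final inequality of regimes C1–C4 from top-affordability.
* **`LawDec.gatedSliceMixLaw_regimeC3`** — the conclusion of `GatedSliceMixLaw'` in regime C3 (`…C4` in `…QuantGatedSliceMixLawC4`).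

[this work]; exchange architecture: this seat (gen 30); flow form / criterion E / usage bounds: prim-quant-stmt g22–g27, arm-1 g39 (this lane).
Nothing here is cited as a published result.  The gluing rows served [cite: KozmaNitzan2024, Conjecture 3 (p. 15)]; product measure
[cite: Grimmett1999, §1.3 p. 10].
-/

noncomputable section

namespace Summit.CriticalPhenomena.PercolationContinuityZ3.Theorems

namespace Quant

open Finset

/-- the two-point law `{lo, hi; g}` (as in `…QuantLawDEC`) -/
local notation3 "TP[" lo ", " hi ", " g ", " h "]" =>
  (g : ℝ) * (if (h : ℕ) = (hi : ℕ) then (1 : ℝ) else 0) + (1 - (g : ℝ)) * (if (h : ℕ) = (lo : ℕ) then (1 : ℝ) else 0)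

namespace LawDec

/-! ### The common final inequality -/

/-- **the zero inequality of regimes C1–C4 from top-affordability**: with `S = (1−z)(k₁ + (k₂−k₁)λ)`, `y·k₂ ≤ S`, `0 < S`, `0 ≤ y`,
`0 ≤ z < 1`, `0 ≤ λ ≤ 1`, `agz ≥ 0`: `y·(z + (1−z)(1−λ)(S − k₁ − agz)/S) ≤ (1−z)λ(1−y)`. [this work] -/
theorem zero_ineq_of_TA (y z g S lam : ℝ) (a k₁ k₂ : ℕ) (hy0 : 0 ≤ y) (hz0 : 0 ≤ z) (hz1 : z < 1) (hg0 : 0 ≤ g)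
    (hlam0 : 0 ≤ lam) (hlam1 : lam ≤ 1) (hS0 : 0 < S) (hmean : (1 - z) * ((k₁ : ℝ) + ((k₂ : ℝ) - k₁) * lam) = S)
    (hyk₂ : y * (k₂ : ℝ) ≤ S) :
    y * (z + (1 - z) * (1 - lam) * (S - k₁ - (a : ℝ) * g * z) / S) ≤ (1 - z) * lam * (1 - y) := by
  have h1z : 0 < 1 - z := by linarith
  have h1lam : 0 ≤ 1 - lam := by linarith
  have hagz : 0 ≤ (a : ℝ) * g * z := mul_nonneg (mul_nonneg (Nat.cast_nonneg a) hg0) hz0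
  have eS : z + (1 - z) * (1 - lam) * (S - k₁ - (a : ℝ) * g * z) / S
      = (z * S + (1 - z) * (1 - lam) * (S - k₁ - (a : ℝ) * g * z)) / S := by
    field_simp
  rw [eS, ← mul_div_assoc, div_le_iff₀ hS0]
  have e : y * (z * S + (1 - z) * (1 - lam) * (S - k₁ - (a : ℝ) * g * z))
      = y * ((1 - z) * lam * k₂) - y * ((1 - z) * (1 - lam) * ((a : ℝ) * g * z)) - y * ((1 - z) * lam * S)
        + y * (S - (1 - z) * ((k₁ : ℝ) + ((k₂ : ℝ) - k₁) * lam)) := by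
    ring
  have hS' : S - (1 - z) * ((k₁ : ℝ) + ((k₂ : ℝ) - k₁) * lam) = 0 := by rw [hmean]; ring
  rw [e, hS', mul_zero, add_zero]
  have t1 : 0 ≤ y * ((1 - z) * (1 - lam) * ((a : ℝ) * g * z)) := mul_nonneg hy0 (mul_nonneg (mul_nonneg h1z.le h1lam) hagz)
  have t2 : y * ((1 - z) * lam * k₂) ≤ (1 - z) * lam * S := by
    have := mul_le_mul_of_nonneg_left hyk₂ (mul_nonneg h1z.le hlam0)
    linarith [this]
  have t3 : (1 - z) * lam * (1 - y) * S = (1 - z) * lam * S - y * ((1 - z) * lam * S) := by ring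
  rw [t3]
  linarith [t1, t2]

/-! ### Regime C3: the twin at most the target -/

set_option maxHeartbeats 800000 in
/-- **`GatedSliceMixLaw'` IN REGIME C3** (`2k₁ < t`, `k₁ ≤ j`; the twin `k₁ + a ≤ j` with `2(k₁+a) ≥ t` and `k₁ + a ≤ t`; `k₂ ≥ j+1`;
`h + a ≤ j`, `2h ≥ t`): the conclusion of `GatedSliceMixLaw'` (`W_h ∉ D` not needed).  The low `k₁` rides `W`'s mids, the twin idles, the zeros
ride the giants. [this work] -/
theorem gatedSliceMixLaw_regimeC3 (y z g S lam : ℝ) (a j M h k₁ k₂ : ℕ)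
    (hy0 : 0 < y) (hy1 : y < 1) (hz0 : 0 ≤ z) (hz1 : z < 1) (hg1 : g ≤ 1) (hyg : y ≤ (1 - z) * g)
    (hS0 : 0 < S) (hta : y * (M : ℝ) ≤ S) (hhM : h ≤ M) (hSh : S < (h : ℝ))
    (hk : k₁ ≤ k₂) (hk₂M : k₂ ≤ M) (hlam0 : 0 ≤ lam) (hlam1 : lam ≤ 1)
    (hmean : (1 - z) * ((k₁ : ℝ) + ((k₂ : ℝ) - k₁) * lam) = S)
    (hk1low : 2 * (k₁ : ℝ) < S + (a : ℝ) * g * (1 - z)) (hlj : k₁ + a ≤ j)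
    (hlmid : S + (a : ℝ) * g * (1 - z) ≤ 2 * ((k₁ + a : ℕ) : ℝ)) (hlt : ((k₁ + a : ℕ) : ℝ) ≤ S + (a : ℝ) * g * (1 - z))
    (hk₂G : j + 1 ≤ k₂) (hhaj : h + a ≤ j) (hhmid : S + (a : ℝ) * g * (1 - z) ≤ 2 * (h : ℝ)) :
    ∃ θ : ℝ, 0 ≤ θ ∧ θ < 1 ∧
      DECAtT y (S + (a : ℝ) * g * (1 - z)) j (M + a)
        (fun p => θ * weakMidLaw S g h a p
          + (1 - θ) * (z * (if p = 0 then (1 : ℝ) else 0) + (1 - z) * slice (fun q => TP[k₁, k₂, lam, q]) a g p)) := by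
  classical
  set t : ℝ := S + (a : ℝ) * g * (1 - z) with ht
  have h1z : 0 < 1 - z := by linarith
  have hg0 : 0 < g := by nlinarith
  have h1y : 0 < 1 - y := by linarith
  have ha0 : (0 : ℝ) ≤ a := Nat.cast_nonneg a
  have hh0 : (0 : ℝ) < h := lt_trans hS0 hSh
  have hk₁0 : (0 : ℝ) ≤ k₁ := Nat.cast_nonneg k₁
  have hSh' : 0 < S / (h : ℝ) := div_pos hS0 hh0
  have hw0 : 0 ≤ 1 - S / (h : ℝ) := by rw [sub_nonneg, div_le_one hh0]; exact hSh.le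
  have h1lam : 0 ≤ 1 - lam := by linarith
  have hyk₂ : y * (k₂ : ℝ) ≤ S := le_trans (mul_le_mul_of_nonneg_left (by exact_mod_cast hk₂M) hy0.le) hta
  have htaha : y * ((h + a : ℕ) : ℝ) ≤ t := by
    have : ((h + a : ℕ) : ℝ) ≤ ((M + a : ℕ) : ℝ) := by exact_mod_cast (by omega : h + a ≤ M + a)
    push_cast at this ⊢; rw [ht]; nlinarith [mul_nonneg ha0 hg0.le]
  set m₁ : ℝ := (1 - z) * (1 - lam) * (1 - g) with hm₁
  set m₁' : ℝ := (1 - z) * (1 - lam) * g with hm₁'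
  have hm₁0 : 0 ≤ m₁ := mul_nonneg (mul_nonneg h1z.le h1lam) (by linarith)
  have hm₁'0 : 0 ≤ m₁' := mul_nonneg (mul_nonneg h1z.le h1lam) hg0.le
  have hm₂0 : 0 ≤ (1 - z) * lam * (1 - g) := mul_nonneg (mul_nonneg h1z.le hlam0) (by linarith)
  have hm₂'0 : 0 ≤ (1 - z) * lam * g := mul_nonneg (mul_nonneg h1z.le hlam0) hg0.le
  -- capacity of the donor k₁ in W's mids
  obtain ⟨K₁, hK₁⟩ : ∃ K : ℝ, K = (if t < (k₁ : ℝ) + h then S / h * (1 - g) / usage y t j k₁ h else 0)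
      + S / h * g / usage y t j k₁ (h + a) := ⟨_, rfl⟩
  have hK₁ge := weakMid_capacity_ge y t S g z j h a k₁ hy0 hy1 hg0.le hg1 hz0 hS0.le hSh ht hk1low hhaj htaha
  rw [← hK₁] at hK₁ge
  have htk₁ : 0 < t - k₁ := by linarith
  have hc0 : 0 < S / h * ((h : ℝ) - S) := mul_pos hSh' (by linarith)
  have hK₁pos : 0 < K₁ := lt_of_lt_of_le (div_pos hc0 htk₁) hK₁ge
  -- balance point
  obtain ⟨ρ, hρ⟩ : ∃ r : ℝ, r = m₁ / K₁ := ⟨_, rfl⟩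
  have hρ0 : 0 ≤ ρ := by rw [hρ]; exact div_nonneg hm₁0 hK₁pos.le
  obtain ⟨θ, hθ⟩ : ∃ q : ℝ, q = ρ / (1 + ρ) := ⟨_, rfl⟩
  have hθ0 : 0 ≤ θ := by rw [hθ]; exact div_nonneg hρ0 (by linarith)
  have hθ1 : θ < 1 := by rw [hθ, div_lt_one (by linarith)]; linarith
  have h1θ : 0 < 1 - θ := by linarith
  have hθρ : θ = (1 - θ) * ρ := by rw [hθ]; field_simp; ring
  have hK₁ne : K₁ ≠ 0 := hK₁pos.ne'
  have hρK : ρ * K₁ = m₁ := by rw [hρ]; field_simp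
  have hθK : θ * K₁ = (1 - θ) * m₁ := by linear_combination K₁ * hθρ + (1 - θ) * hρK
  -- W-side: the whole of W's mids to k₁
  have hhaN : h + a ≤ M + a := by omega
  have hcomp1 : t < (k₁ : ℝ) + ((h + a : ℕ) : ℝ) := by
    push_cast; have : (a : ℝ) * g * (1 - z) ≤ a := by nlinarith [mul_nonneg ha0 hg0.le]
    rw [ht]; linarith
  have hk₁j : k₁ ≤ j := by omega
  have W1 := flowAtT_weakMidShare y t S g θ j (M + a) h a k₁ hy0 hy1 hg0.le hg1 hS0.le hθ0 hk₁j hk1low hhaN hhmid hcomp1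
  rw [← hK₁] at W1
  -- THE inequality
  have hineq : y / (1 - y) * (z + ρ * (1 - S / h)) ≤ (1 - z) * lam := by
    have hb1 : ρ ≤ m₁ * (t - k₁) / (S / h * ((h : ℝ) - S)) := by
      rw [hρ, div_le_div_iff₀ hK₁pos hc0]
      have h1 : S / h * ((h : ℝ) - S) ≤ K₁ * (t - k₁) := (div_le_iff₀ htk₁).1 hK₁ge
      calc m₁ * (S / h * ((h : ℝ) - S)) ≤ m₁ * (K₁ * (t - k₁)) := mul_le_mul_of_nonneg_left h1 hm₁0
        _ = m₁ * (t - k₁) * K₁ := by ring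
    have hne1 : (h : ℝ) ≠ 0 := hh0.ne'
    have hne2 : (h : ℝ) - S ≠ 0 := by intro h0; linarith
    have hne3 : S ≠ 0 := hS0.ne'
    have hρle : ρ * (1 - S / h) ≤ m₁ * (t - k₁) / S := by
      have e : m₁ * (t - k₁) / (S / h * ((h : ℝ) - S)) * (1 - S / h) = m₁ * (t - k₁) / S := by
        rw [show (1 : ℝ) - S / h = ((h : ℝ) - S) / h by field_simp]
        field_simp
      calc ρ * (1 - S / h) ≤ m₁ * (t - k₁) / (S / h * ((h : ℝ) - S)) * (1 - S / h) := mul_le_mul_of_nonneg_right hb1 hw0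
        _ = _ := e
    -- drop the (nonnegative) income of the twin: t − ℓ ≥ 0
    have hinc : m₁ * (t - k₁) ≤ (1 - z) * (1 - lam) * (S - k₁ - (a : ℝ) * g * z) := by
      have e : (1 - z) * (1 - lam) * (S - k₁ - (a : ℝ) * g * z) = m₁ * (t - k₁) + m₁' * (t - ((k₁ + a : ℕ) : ℝ)) := by
        simp only [hm₁, hm₁']; push_cast; rw [ht]; ring
      rw [e]
      have : 0 ≤ m₁' * (t - ((k₁ + a : ℕ) : ℝ)) := mul_nonneg hm₁'0 (by linarith)
      linarith
    rw [div_mul_eq_mul_div, div_le_iff₀ h1y]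
    have key := zero_ineq_of_TA y z g S lam a k₁ k₂ hy0.le hz0 hz1 hg0.le hlam0 hlam1 hS0 hmean hyk₂
    calc y * (z + ρ * (1 - S / h)) ≤ y * (z + (1 - z) * (1 - lam) * (S - k₁ - (a : ℝ) * g * z) / S) := by
          refine mul_le_mul_of_nonneg_left ?_ hy0.le
          have := div_le_div_of_nonneg_right hinc hS0.le
          linarith
      _ ≤ (1 - z) * lam * (1 - y) := key
  -- P-side: the idle twin, and the zeros on the giants
  have Ptwin := flowAtT_point y t j (M + a) (k₁ + a) ((1 - θ) * m₁') (fun hc => by linarith [hc.2]) (mul_nonneg h1θ.le hm₁'0)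
  have Pg : FlowAtT y t j (M + a) (fun p => (θ * (1 - S / h) + (1 - θ) * z) * (if p = 0 then (1 : ℝ) else 0)
      + (1 - θ) * ((1 - z) * lam * (1 - g)) * (if p = k₂ then (1 : ℝ) else 0)
      + (1 - θ) * ((1 - z) * lam * g) * (if p = k₂ + a then (1 : ℝ) else 0)) := by
    have hz' : 0 ≤ θ * (1 - S / h) + (1 - θ) * z := add_nonneg (mul_nonneg hθ0 hw0) (mul_nonneg h1θ.le hz0)
    refine flowAtT_of_giants y t j (M + a) _ hy0 hy1 (fun p => ?_) ?_
    · refine add_nonneg (add_nonneg (mul_nonneg hz' ?_) (mul_nonneg (mul_nonneg h1θ.le hm₂0) ?_))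
        (mul_nonneg (mul_nonneg h1θ.le hm₂'0) ?_) <;> split_ifs <;> norm_num
    · have hl : ∑ l ∈ Finset.range (j + 1), (if 2 * (l : ℝ) < t then
          (θ * (1 - S / h) + (1 - θ) * z) * (if l = 0 then (1 : ℝ) else 0)
            + (1 - θ) * ((1 - z) * lam * (1 - g)) * (if l = k₂ then (1 : ℝ) else 0)
            + (1 - θ) * ((1 - z) * lam * g) * (if l = k₂ + a then (1 : ℝ) else 0) else 0)
          = θ * (1 - S / h) + (1 - θ) * z := by
        have e : ∀ l ∈ Finset.range (j + 1), (if 2 * (l : ℝ) < t then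
            (θ * (1 - S / h) + (1 - θ) * z) * (if l = 0 then (1 : ℝ) else 0)
              + (1 - θ) * ((1 - z) * lam * (1 - g)) * (if l = k₂ then (1 : ℝ) else 0)
              + (1 - θ) * ((1 - z) * lam * g) * (if l = k₂ + a then (1 : ℝ) else 0) else 0)
            = (θ * (1 - S / h) + (1 - θ) * z) * (if l = 0 then (1 : ℝ) else 0) := by
          intro l hl
          have hl' : l ≤ j := Nat.lt_succ_iff.1 (Finset.mem_range.1 hl)
          rw [if_neg (show l ≠ k₂ by omega), if_neg (show l ≠ k₂ + a by omega)]
          by_cases hl0 : l = 0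
          · subst hl0; rw [if_pos (by push_cast; linarith)]; ring
          · rw [if_neg hl0]; split_ifs <;> ring
        rw [Finset.sum_congr rfl e]
        exact sum_mul_indicator (fun _ => θ * (1 - S / h) + (1 - θ) * z) j 0 (by omega)
      have hg' : ∑ p ∈ Finset.Ico (j + 1) (M + a + 1),
          ((θ * (1 - S / h) + (1 - θ) * z) * (if p = 0 then (1 : ℝ) else 0)
            + (1 - θ) * ((1 - z) * lam * (1 - g)) * (if p = k₂ then (1 : ℝ) else 0)
            + (1 - θ) * ((1 - z) * lam * g) * (if p = k₂ + a then (1 : ℝ) else 0)) = (1 - θ) * ((1 - z) * lam) := by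
        have e : ∀ p ∈ Finset.Ico (j + 1) (M + a + 1),
            ((θ * (1 - S / h) + (1 - θ) * z) * (if p = 0 then (1 : ℝ) else 0)
              + (1 - θ) * ((1 - z) * lam * (1 - g)) * (if p = k₂ then (1 : ℝ) else 0)
              + (1 - θ) * ((1 - z) * lam * g) * (if p = k₂ + a then (1 : ℝ) else 0))
              = (1 - θ) * ((1 - z) * lam * (1 - g)) * (if p = k₂ then (1 : ℝ) else 0)
                + (1 - θ) * ((1 - z) * lam * g) * (if p = k₂ + a then (1 : ℝ) else 0) := by
          intro p hp
          have : p ≠ 0 := by have := (Finset.mem_Ico.1 hp).1; omega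
          rw [if_neg this]; ring
        rw [Finset.sum_congr rfl e, Finset.sum_add_distrib, ← Finset.mul_sum, ← Finset.mul_sum,
          Finset.sum_ite_eq' (Finset.Ico (j + 1) (M + a + 1)) k₂, Finset.sum_ite_eq' (Finset.Ico (j + 1) (M + a + 1)) (k₂ + a),
          if_pos (Finset.mem_Ico.2 ⟨hk₂G, by omega⟩), if_pos (Finset.mem_Ico.2 ⟨by omega, by omega⟩)]
        ring
      rw [hl, hg']
      have e1 : θ * (1 - S / h) + (1 - θ) * z = (1 - θ) * (z + ρ * (1 - S / h)) := by linear_combination (1 - S / h) * hθρ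
      rw [e1, show y / (1 - y) * ((1 - θ) * (z + ρ * (1 - S / h))) = (1 - θ) * (y / (1 - y) * (z + ρ * (1 - S / h))) by ring]
      exact mul_le_mul_of_nonneg_left hineq h1θ.le
  -- assemble
  have hsumflow := FlowAtT.add W1 (FlowAtT.add Ptwin Pg)
  have hflow : FlowAtT y t j (M + a) (fun p => θ * weakMidLaw S g h a p
      + (1 - θ) * (z * (if p = 0 then (1 : ℝ) else 0) + (1 - z) * slice (fun q => TP[k₁, k₂, lam, q]) a g p)) := by
    refine (congrArg (FlowAtT y t j (M + a)) (funext fun p => ?_)).mp hsumflow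
    rw [movedTwoPoint_apply, ← hm₁, ← hm₁']
    unfold weakMidLaw
    linear_combination (if p = k₁ then (1 : ℝ) else 0) * hθK
  exact gatedSliceMixLaw_conclusion_of_flowAtT y z g S lam θ a j M h k₁ k₂ hy0 hy1 hhM hk hk₂M hθ0 hθ1 hflow

end LawDec

end Quant

end Summit.CriticalPhenomena.PercolationContinuityZ3.Theorems
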